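import Literature.Geometry.Lorentzian.LocalCausalityExp
import Literature.Geometry.Lorentzian.CausalFutureProofs
import Literature.Geometry.Lorentzian.CauchyHypersurfaceCausalProofs
import HarnessLib

/-!
# The endpoint of a causal curve is causally related to its points
(O'Neill 1983, Ch. 5, Lemma 5.33; Ch. 14, Lemma 14.2 and Cor. 14.1)

For a time-oriented Lorentzian manifold `(M, g, τ)` (Hausdorff, boundaryless model, smooth metric
`∞ ≤ n`) and a future causal curve `γ` on an interval `s` (the tree's
`LorentzianMetric.IsFutureCausalCurveOn`: pointwise differentiable with future-directed causal
velocity) with a **past endpoint** `o` (`HasFutureEndpoint`/`HasPastEndpoint` of `Causality.lean`: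
`γ t → o` as `t` decreases through `s`), every point of the curve is causally after the endpoint:

* `LorentzianMetric.mem_causalFuture_of_hasPastEndpoint` — `γ b ∈ J⁺(o)` for all `b ∈ s`;
* `LorentzianMetric.mem_chronologicalFuture_of_hasPastEndpoint` — for a timelike curve,
  `γ t' ∈ I⁺(o)` whenever `t < t'` in `s` (push-up, O'Neill Cor. 14.1);
* the time duals `mem_causalPast_of_hasFutureEndpoint`, `mem_chronologicalPast_of_hasFutureEndpoint`.

At the endpoint the curve need not be differentiable (it need not even be defined), so this is
not the trivial statement about a curve on a closed parameter interval; it is the local fact used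
implicitly whenever an inextendible curve is cut at the boundary of an open set (e.g. the displayed
hypotheses `hE`, `hE'` of `IsCauchyHypersurface.restrict_of_disjoint_closure`,
`Literature/Geometry/Lorentzian/CauchyPieceDomain.lean`).

Proof. If `s` has a least element the endpoint lies on the curve. Otherwise take the uniformly
normal neighbourhood `W ∋ o` with its smooth two-point inverse `Ξ(q, z) = exp_q⁻¹(z)`
(`exists_twoPoint_expInverse`) and `t₁ ∈ s` below which `γ` stays in `W`. As in
`LocalCausalityExp.lean`, move the base point slightly to the past along the timelike geodesic
`ρ(σ) = exp_o(-σ T_o)`: `exp_{ρ σ}⁻¹(o)` is future timelike, so by continuity `exp_{ρ σ}⁻¹(γ t')`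
is future timelike for `t'` near the past end of `s`; O'Neill's Lemma 5.33
(`radial_timecone_invariance`) along `γ|[t', t₁]` keeps `exp_{ρ σ}⁻¹(γ t₁)` in the open future
timecone; letting `σ → 0⁺` (joint continuity of `Ξ`, closedness of the causal cone in `TM`),
`exp_o⁻¹(γ t₁)` lies in the closed future causal cone of `T_oM`, and the radial geodesic joins `o`
to `γ t₁` (`expMap_mem_causalFuture`). Beyond `t₁` use transitivity of `J⁺`
(`causalFuture_causalFuture_eq`).

Everything is proved; no definitions and no named facts are introduced (D-0026).

## References

* B. O'Neill, *Semi-Riemannian geometry with applications to relativity*, Academic Press 1983,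
  Ch. 5, Lemma 5.33, Prop. 5.34 (pp. 146–147); Ch. 14, Lemma 14.2, Cor. 14.1 (p. 402).
  [ONeillSemiRiemannian1983]
* J. M. Lee, *Introduction to Riemannian Manifolds*, 2nd ed. (2018), Prop. 5.19 (e) (uniformly
  normal neighbourhoods). [LeeRiemannianManifolds2018]
-/

noncomputable section

open Bundle Set Filter Function
open scoped Manifold ContDiff Topology

namespace Literature.Geometry.Lorentzian

open Literature.Geometry.Riemannian

variable {E : Type*} [NormedAddCommGroup E] [NormedSpace ℝ E] {H : Type*} [TopologicalSpace H]
  {I : ModelWithCorners ℝ E H} {M : Type*} [TopologicalSpace M] [ChartedSpace H M]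
  [IsManifold I ∞ M] [FiniteDimensional ℝ E] [CompleteSpace E] [T2Space M] [I.Boundaryless]
  {n : ℕ∞ω} {g : LorentzianMetric I n M} [g.HasLeviCivita]
  [CovariantDerivative.ContMDiffCovariantDerivative g.leviCivita 1] (τ : TimeOrientation g)

namespace LorentzianMetric

/-- **Local form.** Let `W ∋ o` be a uniformly normal neighbourhood of `o` with its two-point
inverse (`exists_twoPoint_expInverse`). If a future causal curve `γ` on an interval `s` without
least element has the past endpoint `o` and lies in `W` below the parameter `t₁ ∈ s`, then
`γ t₁ ∈ J⁺(o)`. Proof: for small `σ > 0` read `γ|[t', t₁]` in the exponential chart at the point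
`ρ σ` slightly to the past of `o` on the timelike geodesic `ρ` with `ρ' 0 = -T_o`; since
`exp_{ρ σ}⁻¹(o)` is future timelike and `γ t' → o`, the chart curve starts in the open timecone for
`t'` near the bottom of `s`, hence ends in it (O'Neill's Lemma 5.33, `radial_timecone_invariance`);
letting `σ → 0⁺`, `exp_o⁻¹(γ t₁)` lies in the closed future causal cone of `T_oM`, and the radial
geodesic joins `o` to `γ t₁` (`expMap_mem_causalFuture`). O'Neill 1983, Ch. 5, Lemma 5.33 and
Ch. 14, Lemma 14.2. [cite: ONeillSemiRiemannian1983, Ch. 5, Lemma 5.33 (pp. 146–147); Ch. 14, Lemma 14.2 (p. 402)] -/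
theorem mem_causalFuture_of_hasPastEndpoint (hn : (∞ : ℕ∞ω) ≤ n) {γ : ℝ → M} {s : Set ℝ}
    (hs : s.OrdConnected) (hγ : g.IsFutureCausalCurveOn τ γ s) {o : M}
    (ho : HasPastEndpoint γ s o) {b : ℝ} (hb : b ∈ s) : γ b ∈ g.causalFuture τ {o} := by
  haveI : Fact (1 ≤ n) := ⟨le_trans (by exact_mod_cast le_top) hn⟩
  haveI := contMDiffCovariantDerivative_leviCivita_infty g.toPseudoRiemannianMetric hn
  have hn2 : (2 : ℕ∞ω) ≤ n := le_trans (WithTop.coe_le_coe.mpr le_top : (2 : ℕ∞ω) ≤ ∞) hn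
  haveI : Nonempty s := ⟨⟨b, hb⟩⟩
  set cov := g.leviCivita with hcov
  -- Case 1: `s` has a least element `a₀`; then `o = γ a₀` lies on the curve
  by_cases hmin : ∃ a₀, IsLeast s a₀
  · obtain ⟨a₀, ha₀⟩ := hmin
    have h1 : HasPastEndpoint γ s (γ a₀) :=
      tendsto_atBot_of_eventually_const (i₀ := (⟨a₀, ha₀.1⟩ : s)) fun i hi ↦
        congrArg γ (le_antisymm hi (ha₀.2 i.2))
    have hoa : o = γ a₀ := tendsto_nhds_unique ho h1
    rw [hoa]
    rcases (ha₀.2 hb).eq_or_lt with h | h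
    · rw [h]; exact subset_causalFuture g τ _ (mem_singleton _)
    · exact Or.inr ⟨γ a₀, rfl, γ, a₀, b, h, hγ.mono (hs.out ha₀.1 hb), rfl, rfl⟩
  -- Case 2: no least element
  have hnomin : ∀ d ∈ s, ∃ d' ∈ s, d' < d := by
    intro d hd
    by_contra h
    push Not at h
    exact hmin ⟨d, hd, h⟩
  -- the uniformly normal neighbourhood and the two-point inverse at `o`
  obtain ⟨W, Src, Ξ, hWo, hoW, hWsrc, hSo, hS0, hSdom, hinjF, hΞ, hΞs, hΦs⟩ :=
    exists_twoPoint_expInverse (cov := cov) o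
  set e := trivializationAt E (TangentSpace I : M → Type _) o with he
  have hbase : e.baseSet = (chartAt H o).source := TangentBundle.trivializationAt_baseSet o
  have hoe : o ∈ e.baseSet := by rw [hbase]; exact hWsrc hoW
  -- the curve is eventually (towards its past end) in `W`; choose `t₁ ≤ b` accordingly
  have hevW : ∀ᶠ t : s in atBot, γ t ∈ W := ho (hWo.mem_nhds hoW)
  obtain ⟨t₁, ht₁s, ht₁b, ht₁W⟩ : ∃ t₁ ∈ s, t₁ ≤ b ∧ ∀ t ∈ s, t ≤ t₁ → γ t ∈ W := by
    obtain ⟨a, ha⟩ := Filter.eventually_atBot.1 hevW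
    refine ⟨min (a : ℝ) b, ?_, min_le_right _ _, fun t ht hta ↦ ?_⟩
    · rcases le_total (a : ℝ) b with h | h
      · rw [min_eq_left h]; exact a.2
      · rw [min_eq_right h]; exact hb
    · exact ha ⟨t, ht⟩ (Subtype.mk_le_mk.2 (le_trans hta (min_le_left _ _)))
  -- it suffices to treat `t₁`
  suffices hmain : γ t₁ ∈ g.causalFuture τ {o} by
    rcases ht₁b.eq_or_lt with h | h
    · rw [← h]; exact hmain
    · have h2 : γ b ∈ g.causalFuture τ {γ t₁} :=
        Or.inr ⟨γ t₁, rfl, γ, t₁, b, h, hγ.mono (hs.out ht₁s hb), rfl, rfl⟩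
      have h3 : γ b ∈ g.causalFuture τ (g.causalFuture τ {o}) :=
        causalFuture_mono (singleton_subset_iff.2 hmain) h2
      rwa [causalFuture_causalFuture_eq hn2] at h3
  /- (A) the chart curve at a base point `q ∈ W` of a causal segment `γ|[a', b'] ⊆ W`:
    `β_q = L_q ∘ Ξ(q, ·) ∘ γ` with `L_q = e.symmL ℝ q`. -/
  have hA : ∀ a' b', a' ≤ b' → Icc a' b' ⊆ s → MapsTo γ (Icc a' b') W → ∀ q ∈ W,
      ∃ β β' : ℝ → E, (∀ t, β t = e.symmL ℝ q (Ξ q (γ t))) ∧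
      (∀ t ∈ Icc a' b', HasDerivAt β (β' t) t) ∧
      (∀ t ∈ Icc a' b', (β t : TangentSpace I q) ∈ expDomain cov q) ∧
      (∀ t ∈ Icc a' b', τ.IsFutureDirected (velocity I (fun s ↦ expMap cov q (β s)) t)) := by
    intro a' b' _ hsub hγW q hq
    have hγ' : g.IsFutureCausalCurveOn τ γ (Icc a' b') := hγ.mono hsub
    have hγc : ∀ t ∈ Icc a' b', ContinuousAt γ t := fun t ht ↦ (hγ' t ht).1.continuousAt
    have hγnear : ∀ t ∈ Icc a' b', ∀ᶠ s in 𝓝 t, γ s ∈ W := fun t ht ↦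
      (hγc t ht).preimage_mem_nhds (hWo.mem_nhds (hγW ht))
    set L : E →L[ℝ] E := e.symmL ℝ q with hL
    set K : M → E := fun z ↦ Ξ q z with hK
    have hKs : ContMDiffOn I 𝓘(ℝ, E) ∞ K W := by
      have h1 : ContMDiff I (I.prod I) ∞ (fun z : M ↦ (q, z)) := contMDiff_const.prodMk contMDiff_id
      exact hΞs.comp h1.contMDiffOn fun z hz ↦ ⟨hq, hz⟩
    set β : ℝ → E := fun t ↦ L (K (γ t)) with hβ
    have hdiff : ∀ t ∈ Icc a' b', DifferentiableAt ℝ (fun s ↦ K (γ s)) t := by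
      intro t ht
      have hKd : MDifferentiableAt I 𝓘(ℝ, E) K (γ t) :=
        (hKs.contMDiffAt (hWo.mem_nhds (hγW ht))).mdifferentiableAt (by simp)
      have h := hKd.comp t (hγ' t ht).1
      exact mdifferentiableAt_iff_differentiableAt.1 h
    set β' : ℝ → E := fun t ↦ L (deriv (fun s ↦ K (γ s)) t) with hβ'
    refine ⟨β, β', fun t ↦ rfl, fun t ht ↦ L.hasFDerivAt.comp_hasDerivAt t (hdiff t ht).hasDerivAt,
      fun t ht ↦ (hSdom _ (hΞ q hq (γ t) (hγW ht)).1).2, fun t ht ↦ ?_⟩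
    have hev : (fun s ↦ expMap cov q (β s)) =ᶠ[𝓝 t] γ := by
      filter_upwards [hγnear t ht] with s hs
      exact (hΞ q hq (γ s) hs).2
    have hvel : velocity I (fun s ↦ expMap cov q (β s)) t = velocity I γ t :=
      velocity_congr_of_eventuallyEq (I := I) hev
    have hpt : expMap cov q (β t) = γ t := hev.eq_of_nhds
    rw [hvel, hpt]
    exact (hγ' t ht).2
  /- (B) the past timelike geodesic `ρ` from `o` with velocity `-T_o` -/
  set u : TangentSpace I o := -τ.vectorField o with hu
  obtain ⟨hρmax, hρ0, hρo, hρv⟩ := maximalGeodesic_spec' (cov := cov) o u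
  set ρ := maximalGeodesic cov o u with hρ
  set Dρ := maximalGeodesicDomain cov o u with hDρ
  have hDo : IsOpen Dρ := hρmax.isOpen
  have hρgeo : IsGeodesicOn cov ρ Dρ := hρmax.isGeodesicOn
  have hupast : τ.reverse.IsFutureDirected u := by
    rw [TimeOrientation.isFutureDirected_reverse_iff]
    have hT := τ.isTimelike o
    refine ⟨(g.isCausal_neg_iff _).2 hT.isCausal, ?_⟩
    show 0 < g.val o (τ.vectorField o) (-τ.vectorField o)
    rw [map_neg]
    exact neg_pos.2 hT
  have hut : g.IsTimelike u := (g.isTimelike_neg_iff _).2 (τ.isTimelike o)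
  have hρ' : ∀ s ∈ Dρ, g.IsTimelike (velocity I ρ s) ∧ τ.IsPastDirected (velocity I ρ s) := by
    intro s hs
    have h := hρgeo.isTimelike_and_isFutureDirected_velocity τ.reverse hDo hρmax.2.1 hρ0
      (by rw [hρv, hρo]; exact hut) (by rw [hρv, hρo]; exact hupast) hs
    exact ⟨h.1, (TimeOrientation.isFutureDirected_reverse_iff _ _).1 h.2⟩
  have hw : ∀ s ∈ Dρ, 0 < s → g.IsTimelike ((-s) • velocity I ρ s) ∧
      τ.IsFutureDirected ((-s) • velocity I ρ s) := by
    intro s hs hs0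
    have hneg : τ.IsFutureDirected (-velocity I ρ s) :=
      (TimeOrientation.isFutureDirected_neg_iff _ _).2 (hρ' s hs).2
    have h1 : (-s) • velocity I ρ s = s • (-velocity I ρ s) := by rw [neg_smul, smul_neg]
    rw [h1]
    exact ⟨((g.isTimelike_neg_iff _).2 (hρ' s hs).1).smul hs0.ne', hneg.smul hs0⟩
  -- `exp_{ρ s}(w_s) = o`: the reversed geodesic
  have hexpw : ∀ s ∈ Dρ, ((-s) • velocity I ρ s) ∈ expDomain cov (ρ s) ∧
      expMap cov (ρ s) ((-s) • velocity I ρ s) = o := by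
    intro s hs
    set κ : ℝ → M := fun r ↦ ρ ((-1) * r + s) with hκ
    set s' : Set ℝ := (fun r ↦ (-1) * r + s) ⁻¹' Dρ with hs'
    have hκgeo : IsGeodesicOn cov κ s' := IsGeodesicOn.comp_affine_holds hρgeo (-1) s
    have hs'o : IsOpen s' := hDo.preimage ((continuous_const.mul continuous_id).add continuous_const)
    have hs'c : s'.OrdConnected := by
      refine ⟨fun x hx y hy r hr ↦ ?_⟩
      show (-1) * r + s ∈ Dρ
      have hx' : (-1) * x + s ∈ Dρ := hx
      have hy' : (-1) * y + s ∈ Dρ := hy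
      exact hρmax.2.1.out hy' hx' ⟨by linarith [hr.2], by linarith [hr.1]⟩
    have h0' : (0 : ℝ) ∈ s' := by show (-1) * 0 + s ∈ Dρ; simpa using hs
    have hκ0 : κ 0 = ρ s := by show ρ ((-1) * 0 + s) = ρ s; simp
    have hκv : velocity I κ 0 = (-1 : ℝ) • velocity I ρ s := by
      have h := velocity_comp_affine (I := I) ρ (-1) s 0
      rw [show (-1 : ℝ) * 0 + s = s by ring] at h
      exact h
    obtain ⟨hsub, heq⟩ := subset_maximalGeodesicDomain_of_isGeodesicOn hs'o hs'c h0' hκgeo hκ0 hκv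
    have hss' : s ∈ s' := by show (-1) * s + s ∈ Dρ; simpa using hρ0
    have hsD : s ∈ maximalGeodesicDomain cov (ρ s) ((-1 : ℝ) • velocity I ρ s) := hsub hss'
    have h := expMap_smul_of_mem (cov := cov) (ρ s) ((-1 : ℝ) • velocity I ρ s) hsD
    rw [smul_smul, mul_neg, mul_one] at h
    refine ⟨h.1, ?_⟩
    rw [h.2, ← heq hss']
    show ρ ((-1) * s + s) = o
    have : (-1) * s + s = 0 := by ring
    rw [this, hρo]
  -- for small `σ > 0`: `ρ σ ∈ W`, `σ ∈ Dρ` and `(ρ σ, ξ_σ) ∈ Src`, `ξ_σ = (-σ) • (e (ρ σ, ρ' σ)).2`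
  set G : ℝ → M × E := fun s ↦ (ρ s, (-s) • (e (tangentLift I ρ s)).2) with hG
  have hGc : ContinuousAt G 0 := by
    have h1 : ContinuousAt (tangentLift I ρ) 0 :=
      (continuousOn_tangentLift_maximalGeodesic (cov := cov) o u).continuousAt (hDo.mem_nhds hρ0)
    have h2 : ContinuousAt e (tangentLift I ρ 0) := by
      refine e.toOpenPartialHomeomorph.continuousAt (e.mem_source.2 ?_)
      show ρ 0 ∈ e.baseSet
      rw [hρo]; exact hoe
    have h3 : ContinuousAt (fun s ↦ (e (tangentLift I ρ s)).2) 0 :=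
      continuousAt_snd.comp (h2.comp h1)
    have h4 : ContinuousAt ρ 0 := (IsGeodesicOn.mdifferentiableAt_holds hρgeo hρ0).continuousAt
    exact h4.prodMk ((continuous_neg.continuousAt).smul h3)
  have hG0 : G 0 = (o, 0) := by
    show (ρ 0, (-(0 : ℝ)) • (e (tangentLift I ρ 0)).2) = (o, 0)
    rw [neg_zero, zero_smul, hρo]
  have hgood : ∀ᶠ s in 𝓝[>] (0 : ℝ), (s ∈ Dρ ∧ ρ s ∈ W ∧ G s ∈ Src) ∧ 0 < s := by
    have h1 : ∀ᶠ s in 𝓝 (0 : ℝ), s ∈ Dρ := hDo.mem_nhds hρ0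
    have h2 : ∀ᶠ s in 𝓝 (0 : ℝ), ρ s ∈ W := by
      have hc : ContinuousAt ρ 0 := hGc.fst
      exact hc.preimage_mem_nhds (hWo.mem_nhds (by show ρ 0 ∈ W; rw [hρo]; exact hoW))
    have h3 : ∀ᶠ s in 𝓝 (0 : ℝ), G s ∈ Src :=
      hGc.preimage_mem_nhds (hSo.mem_nhds (by rw [hG0]; exact hS0 o hoW))
    have h123 := ((h1.and h2).and h3).filter_mono (nhdsWithin_le_nhds (s := Ioi (0 : ℝ)))
    have h4 : ∀ᶠ s in 𝓝[>] (0 : ℝ), 0 < s := eventually_mem_nhdsWithin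
    filter_upwards [h123, h4] with s hs hs'
    exact ⟨⟨hs.1.1, hs.1.2, hs.2⟩, hs'⟩
  /- (C) at a good `σ`, the vector `exp_{ρ σ}⁻¹(γ t₁)` is future timelike -/
  have hstep : ∀ σ, (σ ∈ Dρ ∧ ρ σ ∈ W ∧ G σ ∈ Src) → 0 < σ →
      g.IsTimelike (x := ρ σ) (e.symmL ℝ (ρ σ) (Ξ (ρ σ) (γ t₁))) ∧
      τ.IsFutureDirected (x := ρ σ) (e.symmL ℝ (ρ σ) (Ξ (ρ σ) (γ t₁))) := by
    rintro σ ⟨hσD, hσW, hσSrc⟩ hσ0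
    have hσe : ρ σ ∈ e.baseSet := by rw [hbase]; exact hWsrc hσW
    -- `ξ_σ` and `Ξ (ρ σ) o = ξ_σ`
    set ξs : E := (-σ) • (e (tangentLift I ρ σ)).2 with hξs
    have hξs' : ξs = (e ⟨ρ σ, (-σ) • velocity I ρ σ⟩).2 := by
      rw [hξs, trivializationAt_snd_smul (I := I) (hWsrc hσW)]
      rfl
    have hsymm : e.symmL ℝ (ρ σ) ξs = (-σ) • velocity I ρ σ := by
      rw [hξs', e.symmL_apply hσe, e.symm_apply_apply_mk hσe]
    have hΞσ : Ξ (ρ σ) o = ξs := by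
      have h1 : (ρ σ, Ξ (ρ σ) o) ∈ Src := (hΞ (ρ σ) hσW o hoW).1
      have heq : (fun w : M × E ↦ (w.1, expMap cov w.1 (e.symmL ℝ w.1 w.2))) (ρ σ, Ξ (ρ σ) o) =
          (fun w : M × E ↦ (w.1, expMap cov w.1 (e.symmL ℝ w.1 w.2))) (ρ σ, ξs) := by
        show (ρ σ, expMap cov (ρ σ) (e.symmL ℝ (ρ σ) (Ξ (ρ σ) o))) =
          (ρ σ, expMap cov (ρ σ) (e.symmL ℝ (ρ σ) ξs))
        rw [(hΞ (ρ σ) hσW o hoW).2, hsymm, (hexpw σ hσD).2]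
      exact (Prod.ext_iff.1 (hinjF h1 hσSrc heq)).2
    have hstart : g.IsTimelike (x := ρ σ) (e.symmL ℝ (ρ σ) (Ξ (ρ σ) o)) ∧
        τ.IsFutureDirected (x := ρ σ) (e.symmL ℝ (ρ σ) (Ξ (ρ σ) o)) := by
      rw [hΞσ, hsymm]; exact hw σ hσD hσ0
    -- the open timecone at `ρ σ` and the continuity of `z ↦ exp_{ρ σ}⁻¹ z` at `o`
    set C : Set E := {v : E | g.IsTimelike (x := ρ σ) v ∧ τ.IsFutureDirected (x := ρ σ) v} with hC
    have hCo : IsOpen C := τ.isOpen_setOf_isTimelike_and_isFutureDirected (ρ σ)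
    have hKc : ContinuousAt (fun z : M ↦ e.symmL ℝ (ρ σ) (Ξ (ρ σ) z)) o := by
      have h1 : ContMDiff I (I.prod I) ∞ (fun z : M ↦ (ρ σ, z)) := contMDiff_const.prodMk contMDiff_id
      have h2 : ContMDiffOn I 𝓘(ℝ, E) ∞ (fun z : M ↦ Ξ (ρ σ) z) W :=
        hΞs.comp h1.contMDiffOn fun z hz ↦ ⟨hσW, hz⟩
      have h3 : ContinuousAt (fun z : M ↦ Ξ (ρ σ) z) o :=
        (h2.continuousOn.continuousAt (hWo.mem_nhds hoW))
      exact (e.symmL ℝ (ρ σ)).continuous.continuousAt.comp h3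
    have hN : (fun z : M ↦ e.symmL ℝ (ρ σ) (Ξ (ρ σ) z)) ⁻¹' C ∈ 𝓝 o :=
      hKc.preimage_mem_nhds (hCo.mem_nhds hstart)
    -- a parameter `t' ≤ t₁` of `s` with `γ t'` in that neighbourhood
    obtain ⟨t', ht's, ht't₁, ht'C⟩ : ∃ t' ∈ s, t' ≤ t₁ ∧
        e.symmL ℝ (ρ σ) (Ξ (ρ σ) (γ t')) ∈ C := by
      have h1 : ∀ᶠ t : s in atBot, γ t ∈ (fun z : M ↦ e.symmL ℝ (ρ σ) (Ξ (ρ σ) z)) ⁻¹' C := ho hN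
      have h2 : ∀ᶠ t : s in atBot, (t : ℝ) ≤ t₁ := by
        filter_upwards [eventually_le_atBot (⟨t₁, ht₁s⟩ : s)] with t ht
        exact ht
      obtain ⟨t, ht, ht'⟩ := (h1.and h2).exists
      exact ⟨t, t.2, ht', ht⟩
    -- the chart curve at `ρ σ` of `γ|[t', t₁]`
    have hsub : Icc t' t₁ ⊆ s := hs.out ht's ht₁s
    have hγW : MapsTo γ (Icc t' t₁) W := fun t ht ↦ ht₁W t (hsub ht) ht.2
    obtain ⟨βs, βs', hβsdef, hβsd, hβsdom, hβsfut⟩ := hA t' t₁ ht't₁ hsub hγW (ρ σ) hσW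
    have hβsa : g.IsTimelike (x := ρ σ) (βs t') ∧ τ.IsFutureDirected (x := ρ σ) (βs t') := by
      rw [hβsdef t']; exact ht'C
    obtain ⟨hall, -⟩ := radial_timecone_invariance τ hn hβsd hβsdom hβsfut hβsa.1 hβsa.2
    have h := hall t₁ ⟨ht't₁, le_rfl⟩
    rw [hβsdef t₁] at h
    exact h
  /- (D) pass to the limit `σ → 0⁺` in `TM` -/
  have hcone : g.val o (e.symmL ℝ o (Ξ o (γ t₁))) (e.symmL ℝ o (Ξ o (γ t₁))) ≤ 0 ∧
      g.val o (τ.vectorField o) (e.symmL ℝ o (Ξ o (γ t₁))) ≤ 0 := by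
    have ht₁W' : γ t₁ ∈ W := ht₁W t₁ ht₁s le_rfl
    set Φ : M × M → TangentBundle I M := fun qz ↦
      TotalSpace.mk' E qz.1 (e.symmL ℝ qz.1 (Ξ qz.1 qz.2)) with hΦ
    have hΦc : ContinuousAt Φ (o, γ t₁) :=
      hΦs.continuousOn.continuousAt ((hWo.prod hWo).mem_nhds ⟨hoW, ht₁W'⟩)
    have hpath : Tendsto (fun s ↦ (ρ s, γ t₁)) (𝓝[>] (0 : ℝ)) (𝓝 (o, γ t₁)) := by
      have hc : ContinuousAt ρ 0 := hGc.fst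
      have h1 : Tendsto ρ (𝓝 (0 : ℝ)) (𝓝 o) := by rw [← hρo]; exact hc
      exact ((h1.mono_left nhdsWithin_le_nhds).prodMk_nhds tendsto_const_nhds)
    have hlim : Tendsto (fun s ↦ Φ (ρ s, γ t₁)) (𝓝[>] (0 : ℝ)) (𝓝 (Φ (o, γ t₁))) :=
      hΦc.tendsto.comp hpath
    obtain ⟨hQ₁, hQ₂⟩ := LorentzianMetric.continuous_val_snd_snd g τ
    have hlim₁ := (hQ₁.tendsto _).comp hlim
    have hlim₂ := (hQ₂.tendsto _).comp hlim
    have hev₁ : ∀ᶠ s in 𝓝[>] (0 : ℝ),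
        (fun v : TangentBundle I M ↦ g.val v.proj v.2 v.2) (Φ (ρ s, γ t₁)) ≤ 0 := by
      filter_upwards [hgood] with s hs
      exact le_of_lt (hstep s hs.1 hs.2).1
    have hev₂ : ∀ᶠ s in 𝓝[>] (0 : ℝ),
        (fun v : TangentBundle I M ↦ g.val v.proj (τ.vectorField v.proj) v.2) (Φ (ρ s, γ t₁)) ≤ 0 := by
      filter_upwards [hgood] with s hs
      exact le_of_lt (hstep s hs.1 hs.2).2.2
    exact ⟨le_of_tendsto hlim₁ hev₁, le_of_tendsto hlim₂ hev₂⟩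
  /- (E) conclusion: the radial geodesic from `o` to `γ t₁` -/
  set v : TangentSpace I o := e.symmL ℝ o (Ξ o (γ t₁)) with hv
  have ht₁W' : γ t₁ ∈ W := ht₁W t₁ ht₁s le_rfl
  have hvdom : v ∈ expDomain cov o := (hSdom _ (hΞ o hoW (γ t₁) ht₁W').1).2
  have hexpv : expMap cov o v = γ t₁ := (hΞ o hoW (γ t₁) ht₁W').2
  by_cases hv0 : v = 0
  · have : γ t₁ = o := by rw [← hexpv, hv0]; exact expMap_zero (cov := cov) o
    rw [this]; exact subset_causalFuture g τ _ (mem_singleton _)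
  · have hT : g.IsTimelike (τ.vectorField o) := τ.isTimelike o
    have hvc : g.IsCausal v := ⟨hcone.1, hv0⟩
    have hvf : τ.IsFutureDirected v :=
      ⟨hvc, lt_of_le_of_ne hcone.2 (g.val_ne_zero_of_isTimelike_of_isCausal hT hvc)⟩
    rw [← hexpv]
    exact expMap_mem_causalFuture τ hvdom hvf

/-- **The endpoint property of timelike curves** (the hypothesis `hE` of
`IsCauchyHypersurface.restrict_of_disjoint_closure`): a past endpoint `e` of a future timelike
curve `c` on an interval `s` is chronologically before every point `c t'` preceded by some
`c t`, `t < t'` in `s` — `e ≤ c t ≪ c t'` and push-up (O'Neill 1983, Ch. 14, Cor. 14.1).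
[cite: ONeillSemiRiemannian1983, Ch. 14, Cor. 14.1 (p. 402) and Lemma 14.2] -/
theorem mem_chronologicalFuture_of_hasPastEndpoint (hn : (∞ : ℕ∞ω) ≤ n) {c : ℝ → M} {s : Set ℝ}
    (hs : s.OrdConnected) (hc : g.IsFutureTimelikeCurveOn τ c s) {e : M}
    (he : HasPastEndpoint c s e) {t t' : ℝ} (ht : t ∈ s) (ht' : t' ∈ s) (htt' : t < t') :
    c t' ∈ g.chronologicalFuture τ {e} := by
  have hn1 : (1 : ℕ∞ω) ≤ n := le_trans (by exact_mod_cast le_top) hn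
  have h1 : c t ∈ g.causalFuture τ {e} :=
    mem_causalFuture_of_hasPastEndpoint τ hn hs hc.isFutureCausalCurveOn he ht
  have h2 : c t' ∈ g.chronologicalFuture τ {c t} :=
    ⟨c t, rfl, c, t, t', htt', hc.mono (hs.out ht ht'), rfl, rfl⟩
  exact mem_chronologicalFuture_of_mem_causalFuture hn1 h1 h2

/-- **Time dual: a future endpoint of a causal curve is causally after its points.** If the future
causal curve `γ` on the interval `s` has the future endpoint `o`, then `γ b ≤ o`, i.e.
`γ b ∈ J⁻(o)`, for every `b ∈ s` (the statement for `τ.reverse` and the reversed parameter).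
[cite: ONeillSemiRiemannian1983, Ch. 5, Lemma 5.33 (pp. 146–147); Ch. 14, Lemma 14.2 (p. 402)] -/
theorem mem_causalPast_of_hasFutureEndpoint (hn : (∞ : ℕ∞ω) ≤ n) {γ : ℝ → M} {s : Set ℝ}
    (hs : s.OrdConnected) (hγ : g.IsFutureCausalCurveOn τ γ s) {o : M}
    (ho : HasFutureEndpoint γ s o) {b : ℝ} (hb : b ∈ s) : γ b ∈ g.causalPast τ {o} := by
  have h := mem_causalFuture_of_hasPastEndpoint τ.reverse hn (ordConnected_preimage_neg hs)
    hγ.comp_neg (hasPastEndpoint_comp_neg_iff.2 ho) (b := -b) (by show -(-b) ∈ s; rw [neg_neg]; exact hb)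
  have hb' : (γ ∘ Neg.neg) (-b) = γ b := by show γ (-(-b)) = γ b; rw [neg_neg]
  rw [hb'] at h
  exact h

/-- **Time dual of the endpoint property**: a future endpoint `e` of a future timelike curve `c`
on an interval `s` satisfies `c t ≪ e` for all `t < t'` in `s`.
[cite: ONeillSemiRiemannian1983, Ch. 14, Cor. 14.1 (p. 402) and Lemma 14.2] -/
theorem mem_chronologicalPast_of_hasFutureEndpoint (hn : (∞ : ℕ∞ω) ≤ n) {c : ℝ → M} {s : Set ℝ}
    (hs : s.OrdConnected) (hc : g.IsFutureTimelikeCurveOn τ c s) {e : M}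
    (he : HasFutureEndpoint c s e) {t t' : ℝ} (ht : t ∈ s) (ht' : t' ∈ s) (htt' : t < t') :
    c t ∈ g.chronologicalPast τ {e} := by
  have h := mem_chronologicalFuture_of_hasPastEndpoint τ.reverse hn (ordConnected_preimage_neg hs)
    hc.comp_neg (hasPastEndpoint_comp_neg_iff.2 he) (t := -t') (t' := -t)
    (by show -(-t') ∈ s; rw [neg_neg]; exact ht') (by show -(-t) ∈ s; rw [neg_neg]; exact ht)
    (neg_lt_neg htt')
  rw [neg_neg] at h
  exact h

end LorentzianMetric

end Literature.Geometry.Lorentzian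

end
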